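import Literature.NumberTheory.EllipticCurves.MordellCurveThreeDescent
import Literature.NumberTheory.EllipticCurves.DivisionPolynomialTorsion
import Literature.NumberTheory.EllipticCurves.QuadraticTwist
import Literature.NumberTheory.EllipticCurves.VariableChangePoints
import Literature.NumberTheory.EllipticCurves.KramerDescentLocalGeneratorsProofs
import Literature.NumberTheory.EllipticCurves.ComplexMultiplicationDeuringFrobeniusProofs
import HarnessLib

/-!
# K12r@3: the `3`-torsion criterion — which `j = 0` curves have a `ℚ₃`-rational point of order `3`
# on `E` or on its `3`-isogenous partner `E^{(−3)}`, i.e. the child-E / child-X split of the leaf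
# `WAllCornerFRamifiedAtThree` as a CONGRUENCE on the Mordell coefficient (cell `bsd-print-cfram`, seat p4)

HONEST FRAMING (cell `bsd-print-cfram`, run/shared/lean/pub/bsd-print-cfram/, D-0131 (2) print
tier; verbatim in every file of the seat): the cell works the partition leaf
`CornerF ∧ p ramified in the CM field K` (LADDER-BSD row K7r = B13; W-ALL row 12r) in PARTITION
currency — a leaf or a cell counts only when its theorem is in the kernel BY NAME. This file is
STRUCTURE for the planner's split of the crux `CMRamifiedThreeBSD` (C1, stmt-BirchSwinnertonDyer-20371):
the O11 frame re-typed at `3` (ty2, `X12/O11/RamifiedStrictDescentAtThree*.lean`) carries the two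
local binders `htors : W(ℚ₃)[3] = 0` and `htw : W^{(−3)}(ℚ₃)[3] = 0`; the referee's census (S7,
kit j282157) found them true on 45 of the 98 window classes and false on 53, class-invariantly, and
p3's 3-unit-regime census (Kriz–Li Thm 1.20 at `p = 3`) found its hypothesis (1) `ψ(3) ≠ 1`
holding on exactly 45 classes ⊇ the 27 eligible ones. THIS FILE PROVES WHY, for every `j = 0`
curve at once: both binders hold iff `k ∉ ℚ₃ײ` and `−3k ∉ ℚ₃ײ` for a Mordell model
`y² = x³ + k` of `W`, iff — writing `k = 3ᵃ·m`, `3 ∤ m` — (`a` even and `m ≡ 2 (mod 3)`) or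
(`a` odd and `m ≡ 1 (mod 3)`), which is `χ_{d*}(3) = −1` for the `3`-unramified squarefree class `d*`
of `k`, i.e. Kriz–Li's (1). So the two typed lines at `3` — the Iwasawa line (R-EU)₃ (child E) and
the 3-unit regime — live on the SAME sub-leaf, and its complement (child X: `E[𝔭] ⊂ E(K_𝔭)` at the
ramified prime — one of `E_k`, `E_{−27k}` has a `ℚ₃`-rational kernel of the `√−3`-isogeny) is
decided by a congruence BY NAME. It contains every cube-sum curve `x³ + y³ = n` (`k = −432n²`:
`a` odd, `m = −16n'² ≡ 2`) — the printed HSY/CST/Kezuka–Li/Shu–Yin families — while Kriz–Li's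
sextic family sits in child E. Theorems only; no named fact; nothing about any particular curve.
beyond-print: NO (Silverman Exercise 3.7 + Hensel; the organisation is the cell's).

## Contents
§1 (any field of characteristic `0`): `mordellCurve_Ψ₃_eval`, `mordellCurve_three_torsion_x`,
`mordellCurve_three_nsmul_eq_zero`, `exists_three_torsion_mordellCurve_iff` (order `3` on `y² = x³ + D`
⟺ `D ∈ F²` or (`−3D ∈ F²` and `−4D ∈ F³`)), `noThreeTorsion_mordellCurve_pair_iff`. §2 (`ℚ₃`):
`isSquare_padicThree_iff` (`3ᵃm ∈ ℚ₃ײ ⟺ a` even `∧ m ≡ 1`), `isSquare_neg_three_mul_padicThree_iff`,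
`noThreeTorsion_padicThree_pair_iff`. §3 (models over `ℚ`): `quadraticTwist_mordellCurve`
(`E_k^{(d)} = E_{d³k}`), `quadraticTwist_smul` (`(C • W)^{(d)} = ⟨u, d r, 0, 0⟩ • W^{(d)}`),
`noThreeTorsion_baseChange_iff_of_smul_eq` (ty2's binders are model-invariant), the leaf criterion
**`noThreeTorsion_pair_iff_of_mordell_model`**, and `criterion_neg27` (same criterion for `k`, `−27k`).
References: ty2 `X12/O11/RamifiedStrictDescentAtThreeLeaf.lean`; p3 P3-UNIT-REGIME-CENSUS.md; REF S7; [cite: SilvermanAEC2009, Exercise 3.7 and X.5]; [cite: Serre1973, Ch. II §3.3 Thm 3]; [cite: KrizLi2019, Thm. 1.20 hypothesis (1)].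
-/

set_option autoImplicit false

noncomputable section

open scoped Classical

open WeierstrassCurve Polynomial
open Literature.NumberTheory.EllipticCurves

namespace Summit.BirchSwinnertonDyer.Rank1Residual.X12.JZeroThree

/-! ## §1 Over a field: the points of order `3` on `y² = x³ + D` -/

section FieldLevel

variable {F : Type*} [Field F] [CharZero F]

omit [CharZero F] in
/-- `Ψ₃` of the Mordell curve `y² = x³ + D` is `3x⁴ + 12 D x = 3x(x³ + 4D)`. [folklore] -/
theorem mordellCurve_Ψ₃_eval (D x : F) :
    (mordellCurve D).Ψ₃.eval x = 3 * x * (x ^ 3 + 4 * D) := by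
  simp only [WeierstrassCurve.Ψ₃, mordellCurve, WeierstrassCurve.b₂, WeierstrassCurve.b₄,
    WeierstrassCurve.b₆, WeierstrassCurve.b₈, eval_add, eval_mul, eval_pow, eval_C, eval_X,
    eval_ofNat]
  ring

/-- **The abscissa of a point of order `3` on `y² = x³ + D`** (`D ≠ 0`, characteristic `0`): if
`P = (x, y)` and `3P = O` then `x = 0` (so `y² = D`) or `x³ = −4D` (so `y² = −3D`). Proof: `P`
is not `2`-torsion (else `3P = P ≠ O`), so Mathlib's group law gives `3P = O ↔ Ψ₃(x) = 0`
(tree `three_smul_some_eq_zero_iff`), and `Ψ₃ = 3x(x³ + 4D)`. [cite: SilvermanAEC2009, Exercise 3.7] -/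
theorem mordellCurve_three_torsion_x {D : F} {x y : F}
    (h : (mordellCurve D).toAffine.Nonsingular x y)
    (h3 : (3 : ℕ) • (Affine.Point.some x y h : (mordellCurve D).toAffine.Point) = 0) :
    (x = 0 ∧ y ^ 2 = D) ∨ (x ^ 3 = -4 * D ∧ y ^ 2 = -3 * D) := by
  have heq : y ^ 2 = x ^ 3 + D := (mordellCurve_equation_iff D x y).mp h.left
  -- `P` is not `2`-torsion
  have hy : y ≠ (mordellCurve D).toAffine.negY x y := by
    intro hy
    have h2 : (Affine.Point.some x y h : (mordellCurve D).toAffine.Point) +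
        Affine.Point.some x y h = 0 := Affine.Point.add_self_of_Y_eq hy
    have : (3 : ℕ) • (Affine.Point.some x y h : (mordellCurve D).toAffine.Point) =
        Affine.Point.some x y h := by
      rw [show (3 : ℕ) = 2 + 1 from rfl, add_nsmul, two_nsmul, one_nsmul, h2, zero_add]
    rw [this] at h3
    exact Affine.Point.some_ne_zero h h3
  have h3' : (3 : ℤ) • (Affine.Point.some x y h : (mordellCurve D).toAffine.Point) = 0 := by
    rw [show (3 : ℤ) = ((3 : ℕ) : ℤ) from rfl, natCast_zsmul]; exact h3
  have hΨ := ((mordellCurve D).three_smul_some_eq_zero_iff h hy).mp h3'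
  rw [ψ_three, evalEval_C, mordellCurve_Ψ₃_eval] at hΨ
  have hx : x = 0 ∨ x ^ 3 + 4 * D = 0 := (mul_eq_zero.mp hΨ).imp_left
    fun h1 ↦ (mul_eq_zero.mp h1).resolve_left (by norm_num)
  rcases hx with hx | hx
  · exact Or.inl ⟨hx, by rw [heq, hx]; ring⟩
  · have hx3 : x ^ 3 = -4 * D := by linear_combination hx
    exact Or.inr ⟨hx3, by rw [heq, hx3]; ring⟩

/-- A point `(x, y)` of `y² = x³ + D` with `Ψ₃(x) = 3x(x³ + 4D) = 0` and `y ≠ 0` has order `3`.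
[cite: SilvermanAEC2009, Exercise 3.7] -/
theorem mordellCurve_three_nsmul_eq_zero {D : F} {x y : F}
    (h : (mordellCurve D).toAffine.Nonsingular x y) (hy0 : y ≠ 0)
    (hx : x = 0 ∨ x ^ 3 = -4 * D) :
    (3 : ℕ) • (Affine.Point.some x y h : (mordellCurve D).toAffine.Point) = 0 := by
  have hy : y ≠ (mordellCurve D).toAffine.negY x y := by
    rw [mordellCurve_negY]; exact fun hyy ↦ hy0 (by linear_combination hyy / 2)
  have h3' : (3 : ℤ) • (Affine.Point.some x y h : (mordellCurve D).toAffine.Point) = 0 := by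
    refine ((mordellCurve D).three_smul_some_eq_zero_iff h hy).mpr ?_
    rw [ψ_three, evalEval_C, mordellCurve_Ψ₃_eval]
    rcases hx with hx | hx
    · rw [hx]; ring
    · rw [show x ^ 3 + 4 * D = 0 by linear_combination hx]; ring
  rwa [show (3 : ℤ) = ((3 : ℕ) : ℤ) from rfl, natCast_zsmul] at h3'

/-- **Points of order `3` on `y² = x³ + D` over a field of characteristic `0`** (`D ≠ 0`): there is
one iff `D` is a square (the points `(0, ±√D)` — the kernel of the `3`-isogeny
`E_D → E_{−27D}`) or `−3D` is a square AND `−4D` is a cube (the points `(∛(−4D), ±√(−3D))`).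
[cite: SilvermanAEC2009, Exercise 3.7] -/
theorem exists_three_torsion_mordellCurve_iff {D : F} (hD : D ≠ 0) :
    (∃ P : (mordellCurve D).toAffine.Point, P ≠ 0 ∧ (3 : ℕ) • P = 0) ↔
      IsSquare D ∨ (IsSquare (-3 * D) ∧ ∃ x : F, x ^ 3 = -4 * D) := by
  constructor
  · rintro ⟨P, hP0, hP3⟩
    rcases P with _ | ⟨x, y, h⟩
    · exact (hP0 rfl).elim
    rcases mordellCurve_three_torsion_x h hP3 with ⟨-, hy⟩ | ⟨hx, hy⟩
    · exact Or.inl ⟨y, by rw [← hy]; ring⟩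
    · exact Or.inr ⟨⟨y, by rw [← hy]; ring⟩, x, hx⟩
  · rintro (⟨s, hs⟩ | ⟨⟨s, hs⟩, x, hx⟩)
    · have hs0 : s ≠ 0 := by rintro rfl; exact hD (by rw [hs]; ring)
      have heq : (mordellCurve D).toAffine.Equation 0 s := by
        rw [mordellCurve_equation_iff]; rw [hs]; ring
      refine ⟨Affine.Point.some 0 s (nonsingular_mordellCurve_of_equation hD heq),
        Affine.Point.some_ne_zero _, ?_⟩
      exact mordellCurve_three_nsmul_eq_zero _ hs0 (Or.inl rfl)
    · have hs0 : s ≠ 0 := by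
        rintro rfl
        exact hD (by linear_combination -hs / 3)
      have heq : (mordellCurve D).toAffine.Equation x s := by
        rw [mordellCurve_equation_iff, hx]; linear_combination -hs
      refine ⟨Affine.Point.some x s (nonsingular_mordellCurve_of_equation hD heq),
        Affine.Point.some_ne_zero _, ?_⟩
      exact mordellCurve_three_nsmul_eq_zero _ hs0 (Or.inr hx)

omit [CharZero F] in
/-- `A[3] = 0` iff there is no non-zero element killed by `3`. [folklore] -/
theorem forall_three_nsmul_iff_not_exists {A : Type*} [AddCommGroup A] :
    (∀ P : A, (3 : ℕ) • P = 0 → P = 0) ↔ ¬ (∃ P : A, P ≠ 0 ∧ (3 : ℕ) • P = 0) := by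
  simp only [not_exists, not_and]
  exact ⟨fun h P hP0 hP3 ↦ hP0 (h P hP3), fun h P hP3 ↦ by_contra fun hP0 ↦ h P hP0 hP3⟩

omit [CharZero F] in
/-- `IsSquare (c² · a) ↔ IsSquare a` for `c ≠ 0` in a field. [folklore] -/
theorem isSquare_mul_sq_iff' {a c : F} (hc : c ≠ 0) : IsSquare (c ^ 2 * a) ↔ IsSquare a := by
  constructor
  · rintro ⟨s, hs⟩
    exact ⟨s / c, by field_simp; linear_combination hs⟩
  · rintro ⟨s, hs⟩
    exact ⟨c * s, by rw [hs]; ring⟩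

/-- **The pair criterion.** For `D ≠ 0` over a field of characteristic `0`: NEITHER `y² = x³ + D`
NOR its `3`-isogenous partner / `−3`-twist `y² = x³ − 27D` has a rational point of order `3` iff
neither `D` nor `−3D` is a square. (The cube conditions of `exists_three_torsion_mordellCurve_iff`
drop out: the second kind of `3`-torsion point on `E_D` needs `√(−3D)`, on `E_{−27D}` needs
`√(81 D) ∼ √D`.) [cite: SilvermanAEC2009, Exercise 3.7] -/
theorem noThreeTorsion_mordellCurve_pair_iff {D : F} (hD : D ≠ 0) :
    ((∀ P : (mordellCurve D).toAffine.Point, (3 : ℕ) • P = 0 → P = 0) ∧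
      (∀ P : (mordellCurve (-27 * D)).toAffine.Point, (3 : ℕ) • P = 0 → P = 0)) ↔
      (¬ IsSquare D ∧ ¬ IsSquare (-3 * D)) := by
  have hD' : (-27 * D : F) ≠ 0 := mul_ne_zero (by norm_num) hD
  have e1 : IsSquare (-27 * D) ↔ IsSquare (-3 * D) := by
    rw [show (-27 * D : F) = 3 ^ 2 * (-3 * D) by ring]
    exact isSquare_mul_sq_iff' (by norm_num)
  have e2 : IsSquare (-3 * (-27 * D)) ↔ IsSquare D := by
    rw [show (-3 * (-27 * D) : F) = 9 ^ 2 * D by ring]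
    exact isSquare_mul_sq_iff' (by norm_num)
  rw [forall_three_nsmul_iff_not_exists, forall_three_nsmul_iff_not_exists,
    exists_three_torsion_mordellCurve_iff hD, exists_three_torsion_mordellCurve_iff hD', e1, e2]
  tauto

end FieldLevel

/-! ## §2 Squares in `ℚ₃` of the shape `3ᵃ·m`, `3 ∤ m`, and the pair criterion at `ℚ₃` -/

section PadicThree

/-- In `𝔽₃` the only non-zero square is `1`. [folklore] -/
theorem zmod_three_eq_one_of_isSquare {z : ZMod 3} (hz : z ≠ 0) (hsq : IsSquare z) : z = 1 := by
  revert z; decide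

/-- **Squares in `ℚ₃`:** for `3 ∤ m`, `3ᵃ·m` is a square in `ℚ₃` iff `a` is even and
`m ≡ 1 (mod 3)` (Hensel / Serre, *Cours d'arithmétique* II.3.3; tree
`KramerLocal.padic_isSquare_pow_mul`, `DeuringLadic.isSquare_zmod_of_isSquare_padic`).
[cite: Serre1973, Ch. II §3.3 Thm 3] -/
theorem isSquare_padicThree_iff {a : ℕ} {m : ℤ} (hm : ¬ (3 : ℤ) ∣ m) :
    IsSquare ((((3 : ℤ) ^ a * m : ℤ)) : ℚ_[3]) ↔ Even a ∧ ((m : ZMod 3) = 1) := by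
  have hm0 : m ≠ 0 := fun h => hm (h ▸ dvd_zero 3)
  have hmz : ((m : ℤ) : ZMod 3) ≠ 0 := by
    rwa [Ne, ZMod.intCast_zmod_eq_zero_iff_dvd]
  have hmQ : ((m : ℤ) : ℚ_[3]) ≠ 0 := by exact_mod_cast hm0
  have h3Q : ((3 : ℚ_[3])) ≠ 0 := by exact_mod_cast (by norm_num : (3 : ℕ) ≠ 0)
  have hcast : ((((3 : ℤ) ^ a * m : ℤ)) : ℚ_[3]) = (3 : ℚ_[3]) ^ a * (m : ℚ_[3]) := by push_cast; ring
  constructor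
  · rintro ⟨s, hs⟩
    rw [hcast] at hs
    have hs0 : s ≠ 0 := by
      rintro rfl
      exact (mul_ne_zero (pow_ne_zero _ h3Q) hmQ) (by rw [hs, mul_zero])
    -- valuations: `a = 2 v(s)`
    have hval : (a : ℤ) = s.valuation + s.valuation := by
      have h1 : ((3 : ℚ_[3]) ^ a * (m : ℚ_[3])).valuation = a := by
        rw [Padic.valuation_mul (pow_ne_zero _ h3Q) hmQ, Padic.valuation_pow,
          Padic.valuation_intCast, padicValInt.eq_zero_of_not_dvd hm]
        have : ((3 : ℚ_[3])) = ((3 : ℕ) : ℚ_[3]) := by norm_cast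
        rw [this, Padic.valuation_p]; ring
      rw [← h1, hs, Padic.valuation_mul hs0 hs0]
    have heven : Even a := by
      rw [← Int.even_coe_nat, hval]; exact ⟨_, rfl⟩
    refine ⟨heven, ?_⟩
    obtain ⟨k, hk⟩ := heven
    -- `m = (s / 3ᵏ)²` in `ℚ₃`
    have hmsq : IsSquare ((m : ℤ) : ℚ_[3]) := by
      refine ⟨s / (3 : ℚ_[3]) ^ k, ?_⟩
      have h3k : ((3 : ℚ_[3])) ^ k ≠ 0 := pow_ne_zero _ h3Q
      field_simp
      rw [hk, pow_add] at hs
      linear_combination hs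
    exact zmod_three_eq_one_of_isSquare hmz (DeuringLadic.isSquare_zmod_of_isSquare_padic hmsq)
  · rintro ⟨⟨k, hk⟩, h1⟩
    have hsq : IsSquare ((m : ℤ) : ZMod 3) := ⟨1, by rw [h1]; ring⟩
    have h := KramerLocal.padic_isSquare_pow_mul (p := 3) (by decide) k hmz hsq
    rw [hk, ← two_mul]
    exact_mod_cast h

/-- `−3·(3ᵃ·m) = 3ᵃ⁺¹·(−m)`: **`−3·(3ᵃ m)` is a square in `ℚ₃` iff `a` is odd and `m ≡ 2 (mod 3)`**.
[cite: Serre1973, Ch. II §3.3 Thm 3] -/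
theorem isSquare_neg_three_mul_padicThree_iff {a : ℕ} {m : ℤ} (hm : ¬ (3 : ℤ) ∣ m) :
    IsSquare ((((-3) * ((3 : ℤ) ^ a * m) : ℤ)) : ℚ_[3]) ↔ Odd a ∧ ((m : ZMod 3) = 2) := by
  have hm' : ¬ (3 : ℤ) ∣ -m := fun h => hm (dvd_neg.mp h)
  have e : ((-3) * ((3 : ℤ) ^ a * m) : ℤ) = (3 : ℤ) ^ (a + 1) * (-m) := by ring
  rw [e, isSquare_padicThree_iff hm', Nat.even_add_one, Nat.not_even_iff_odd, Int.cast_neg,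
    neg_eq_iff_eq_neg]
  constructor <;> rintro ⟨ho, h⟩ <;> exact ⟨ho, by rw [h]; decide⟩

/-- **The pair criterion at `ℚ₃` as a congruence.** For `k = 3ᵃ·m` with `3 ∤ m`: neither
`y² = x³ + k` nor `y² = x³ − 27k` has a `ℚ₃`-rational point of order `3` iff
(`a` even and `m ≡ 2 (mod 3)`) or (`a` odd and `m ≡ 1 (mod 3)`) — i.e. iff the `3`-free part of
`k`, signed by `(−1)ᵃ`, is `≡ 2 (mod 3)`; equivalently `χ_{d*}(3) = −1` for the `3`-unramified
squarefree class `d*` of `k` (Kriz–Li's hypothesis (1) at `p = 3`). [cite: SilvermanAEC2009, Exercise 3.7]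
[cite: Serre1973, Ch. II §3.3 Thm 3] -/
theorem noThreeTorsion_padicThree_pair_iff {a : ℕ} {m : ℤ} (hm : ¬ (3 : ℤ) ∣ m) :
    ((∀ P : (mordellCurve ((((3 : ℤ) ^ a * m : ℤ)) : ℚ_[3])).toAffine.Point,
        (3 : ℕ) • P = 0 → P = 0) ∧
      (∀ P : (mordellCurve (-27 * ((((3 : ℤ) ^ a * m : ℤ)) : ℚ_[3]))).toAffine.Point,
        (3 : ℕ) • P = 0 → P = 0)) ↔
      ((Even a ∧ (m : ZMod 3) = 2) ∨ (Odd a ∧ (m : ZMod 3) = 1)) := by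
  have hm0 : m ≠ 0 := fun h => hm (h ▸ dvd_zero 3)
  have hmz : ((m : ℤ) : ZMod 3) ≠ 0 := by
    rwa [Ne, ZMod.intCast_zmod_eq_zero_iff_dvd]
  have hm12 : (m : ZMod 3) = 1 ∨ (m : ZMod 3) = 2 := by
    have h12 : ∀ z : ZMod 3, z ≠ 0 → z = 1 ∨ z = 2 := by decide
    exact h12 _ hmz
  have hk0 : ((((3 : ℤ) ^ a * m : ℤ)) : ℚ_[3]) ≠ 0 := by
    have h : ((3 : ℤ) ^ a * m) ≠ 0 := mul_ne_zero (pow_ne_zero _ (by norm_num)) hm0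
    exact_mod_cast h
  rw [noThreeTorsion_mordellCurve_pair_iff hk0]
  have e3 : (-3 * ((((3 : ℤ) ^ a * m : ℤ)) : ℚ_[3])) = ((((-3) * ((3 : ℤ) ^ a * m) : ℤ)) : ℚ_[3]) := by
    push_cast; ring
  rw [e3, isSquare_padicThree_iff hm, isSquare_neg_three_mul_padicThree_iff hm]
  rcases Nat.even_or_odd a with ha | ha
  · have hna : ¬ Odd a := Nat.not_odd_iff_even.mpr ha
    rcases hm12 with h | h <;> simp [ha, hna, h] <;> decide
  · have hna : ¬ Even a := Nat.not_even_iff_odd.mpr ha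
    rcases hm12 with h | h <;> simp [ha, hna, h] <;> decide

end PadicThree

/-! ## §3 From `ℚ₃`-models to any model over `ℚ`: quadratic twists of variable-changed models, transport of "no `3`-torsion", and the leaf criterion -/

section Models

variable {F : Type*} [Field F] [CharZero F]

/-- **The quadratic twist of the Mordell curve**: `(y² = x³ + k)^{(d)} = (y² = x³ + d³k)`
(`b₂ = b₄ = 0`, `b₆ = 4k`). In particular the `−3`-twist of `E_k` is `E_{−27k}`, its `3`-isogenous
partner. [cite: SilvermanAEC2009, X.5 Cor. 5.4] -/
theorem quadraticTwist_mordellCurve (k d : F) :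
    (mordellCurve k).quadraticTwist d = mordellCurve (d ^ 3 * k) := by
  ext
  · rfl
  · simp [quadraticTwist_a₂, mordellCurve, WeierstrassCurve.b₂]
  · rfl
  · simp [quadraticTwist_a₄, mordellCurve, WeierstrassCurve.b₄]
  · simp [quadraticTwist_a₆, mordellCurve, WeierstrassCurve.b₆]; ring

/-- **Twisting commutes with changes of variables up to an explicit change of variables**:
`(C • W)^{(d)} = ⟨u, d·r, 0, 0⟩ • W^{(d)}` for `C = ⟨u, r, s, t⟩` — the `b`-invariants of `C • W`
are `u⁻²(b₂ + 12r)`, `u⁻⁴(b₄ + r b₂ + 6r²)`, `u⁻⁶(b₆ + 2r b₄ + r² b₂ + 4r³)`. So the twist of a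
curve does not depend on the model, up to `ℚ`-isomorphism. [cite: SilvermanAEC2009, III.1 Table 3.1 and X.5] -/
theorem quadraticTwist_smul (C : VariableChange F) (W : WeierstrassCurve F) (d : F) :
    (C • W).quadraticTwist d = (⟨C.u, d * C.r, 0, 0⟩ : VariableChange F) • W.quadraticTwist d := by
  ext
  · simp [quadraticTwist_a₁, variableChange_a₁]
  · simp only [quadraticTwist_a₂, variableChange_b₂, variableChange_a₂, quadraticTwist_a₁]
    ring
  · simp [quadraticTwist_a₃, variableChange_a₃]
  · simp only [quadraticTwist_a₄, variableChange_b₄, variableChange_a₄, quadraticTwist_a₁,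
      quadraticTwist_a₂, quadraticTwist_a₃]
    ring
  · simp only [quadraticTwist_a₆, variableChange_b₆, variableChange_a₆, quadraticTwist_a₁,
      quadraticTwist_a₂, quadraticTwist_a₃, quadraticTwist_a₄]
    ring

omit [CharZero F] in
/-- "No point of order `3`" is invariant under isomorphisms of abelian groups. [folklore] -/
theorem noThreeTorsion_iff_of_addEquiv {A B : Type*} [AddCommGroup A] [AddCommGroup B]
    (e : A ≃+ B) :
    (∀ a : A, (3 : ℕ) • a = 0 → a = 0) ↔ (∀ b : B, (3 : ℕ) • b = 0 → b = 0) := by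
  refine ⟨fun h b hb ↦ ?_, fun h a ha ↦ ?_⟩
  · simpa using congrArg e (h (e.symm b) (by rw [← map_nsmul, hb, map_zero]))
  · simpa using congrArg e.symm (h (e a) (by rw [← map_nsmul, ha, map_zero]))

/-- **No `3`-torsion over an extension `L` is a property of the curve, not of the model**: if
`C • V = V'` over `ℚ` then `V(L)[3] = 0 ↔ V'(L)[3] = 0` (the change of variables is an isomorphism
of the point groups over every `ℚ`-algebra `L`; tree `VariableChange.pointEquiv`).
[cite: SilvermanAEC2009, III.3.1(b) and proof of III.2.5] -/
theorem noThreeTorsion_baseChange_iff_of_smul_eq {V V' : WeierstrassCurve ℚ}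
    {C : VariableChange ℚ} (h : C • V = V') (L : Type*) [Field L] [Algebra ℚ L] :
    (∀ Q : (V.baseChange L).toAffine.Point, (3 : ℕ) • Q = 0 → Q = 0) ↔
      (∀ Q : (V'.baseChange L).toAffine.Point, (3 : ℕ) • Q = 0 → Q = 0) := by
  have hmodel : V'.baseChange L = (C.map (algebraMap ℚ L)) • V.baseChange L := by
    rw [← h, baseChange, baseChange, map_variableChange]
  rw [hmodel]
  exact noThreeTorsion_iff_of_addEquiv
    (VariableChange.pointEquiv (V.baseChange L) (C.map (algebraMap ℚ L)))

/-- **THE LEAF CRITERION (child E / child X of K12r@3 as a congruence).** Let `W/ℚ` be ANY model of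
a `j = 0` curve, `C • W = (y² = x³ + k)` with `k = 3ᵃ·m ∈ ℤ`, `3 ∤ m`. Then the two local binders of
the O11@3 frame (ty2 `RamifiedStrictDescentAtThree*`: `htors` = no `ℚ₃`-point of order `3` on `W`,
`htw` = none on the twist `W^{(−3)}`, i.e. on the `3`-isogenous partner) hold TOGETHER iff
`a` is even and `m ≡ 2 (mod 3)`, or `a` is odd and `m ≡ 1 (mod 3)` — equivalently `χ_{d*}(3) = −1`
for the `3`-unramified squarefree class `d*` of `k`, which is Kriz–Li's hypothesis (1) `ψ(3) ≠ 1`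
at `p = 3` (p3's census binder `h1`); the complementary classes (`k ∈ ℚ₃ײ` or `−3k ∈ ℚ₃ײ`:
`E[𝔭] ⊂ E(K_𝔭)` at the ramified prime) are exactly those where `W` or `W^{(−3)}` carries a
`ℚ₃`-rational kernel of the `√−3`-isogeny. [cite: SilvermanAEC2009, Exercise 3.7 and X.5]
[cite: Serre1973, Ch. II §3.3 Thm 3] [cite: KrizLi2019, Thm. 1.20 hypothesis (1)] -/
theorem noThreeTorsion_pair_iff_of_mordell_model (W : WeierstrassCurve ℚ) {C : VariableChange ℚ}
    {a : ℕ} {m : ℤ} (hm : ¬ (3 : ℤ) ∣ m)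
    (hW : C • W = mordellCurve ((((3 : ℤ) ^ a * m : ℤ)) : ℚ)) :
    ((∀ Q : (W.baseChange ℚ_[3]).toAffine.Point, (3 : ℕ) • Q = 0 → Q = 0) ∧
      (∀ Q : ((W.quadraticTwist (-3 : ℚ)).baseChange ℚ_[3]).toAffine.Point,
        (3 : ℕ) • Q = 0 → Q = 0)) ↔
      ((Even a ∧ (m : ZMod 3) = 2) ∨ (Odd a ∧ (m : ZMod 3) = 1)) := by
  set k : ℤ := (3 : ℤ) ^ a * m with hk
  -- the first binder, transported to the Mordell model over `ℚ₃`
  have h1 := noThreeTorsion_baseChange_iff_of_smul_eq hW ℚ_[3]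
  rw [mordellCurve_baseChange, map_intCast] at h1
  -- the twist: `W^{(−3)} = C' • (y² = x³ − 27k)` for an explicit `C'`
  have hW' : W = C⁻¹ • mordellCurve ((k : ℤ) : ℚ) := eq_inv_smul_iff.mpr hW
  have htw : (⟨C⁻¹.u, (-3 : ℚ) * C⁻¹.r, 0, 0⟩ : VariableChange ℚ)⁻¹ • W.quadraticTwist (-3 : ℚ) =
      mordellCurve ((-3 : ℚ) ^ 3 * ((k : ℤ) : ℚ)) := by
    rw [inv_smul_eq_iff, hW', quadraticTwist_smul, quadraticTwist_mordellCurve]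
  have h2 := noThreeTorsion_baseChange_iff_of_smul_eq htw ℚ_[3]
  rw [mordellCurve_baseChange, map_mul, map_pow, map_neg, map_intCast, map_ofNat] at h2
  rw [h1, h2, show ((-3 : ℚ_[3]) ^ 3 * ((k : ℤ) : ℚ_[3])) = -27 * ((k : ℤ) : ℚ_[3]) by norm_num]
  exact noThreeTorsion_padicThree_pair_iff hm

/-- **Class-invariance on the `j = 0` edge.** The criterion for `k = 3ᵃ·m` and for the partner
`−27k = 3ᵃ⁺³·(−m)` coincide (`a ↦ a + 3` flips parity, `m ↦ −m` swaps `1 ↔ 2 (mod 3)`), as it must: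
the pair `{E_k, E_{−27k}}` is the same. [folklore] -/
theorem criterion_neg27 (a : ℕ) {m : ℤ} (hm : ¬ (3 : ℤ) ∣ m) :
    ((Even (a + 3) ∧ ((-m : ℤ) : ZMod 3) = 2) ∨ (Odd (a + 3) ∧ ((-m : ℤ) : ZMod 3) = 1)) ↔
      ((Even a ∧ (m : ZMod 3) = 2) ∨ (Odd a ∧ (m : ZMod 3) = 1)) := by
  have hmz : ((m : ℤ) : ZMod 3) ≠ 0 := by
    rwa [Ne, ZMod.intCast_zmod_eq_zero_iff_dvd]
  have hm12 : (m : ZMod 3) = 1 ∨ (m : ZMod 3) = 2 := by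
    have h12 : ∀ z : ZMod 3, z ≠ 0 → z = 1 ∨ z = 2 := by decide
    exact h12 _ hmz
  have e3 : Even (a + 3) ↔ Odd a := by
    rw [show a + 3 = (a + 1) + 2 from rfl, Nat.even_add, Nat.even_add_one]; simp
  have o3 : Odd (a + 3) ↔ Even a := by rw [← Nat.not_even_iff_odd, e3, Nat.not_odd_iff_even]
  rw [e3, o3, Int.cast_neg]
  rcases Nat.even_or_odd a with ha | ha
  · have hna : ¬ Odd a := Nat.not_odd_iff_even.mpr ha
    rcases hm12 with h | h <;> simp [ha, hna, h] <;> decide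
  · have hna : ¬ Even a := Nat.not_even_iff_odd.mpr ha
    rcases hm12 with h | h <;> simp [ha, hna, h] <;> decide

end Models

end Summit.BirchSwinnertonDyer.Rank1Residual.X12.JZeroThree

end
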